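import Literature.AlgebraicGeometry.Frobenioids.ArithmeticRealificationPicCone
import Mathlib.CategoryTheory.EssentialImage
import HarnessLib

/-!
# Frobenioids I, Corollary 5.4 at the arithmetic Frobenioid `C_{K/F}`: essential surjectivity of the
# realification functor `C^un-tr → C^rlf` (sub-DAG row C54-core-arith, file 3 of 5: input (a′))

Mochizuki, *The geometry of Frobenioids I: the general theory*, Kyushu J. Math. **62** (2008) 293–400,
Corollary 5.4 p. 104 (1-uniqueness of `Ψ^rlf`) applied to the arithmetic Frobenioids of Example 6.3 / Theorem 6.4
pp. 113–116; Thm. 6.4 (i) p. 115 l. 27–33: "`(Φ^rlf)^gp(L) = ArithDiv_ℝ(L)` … `δ_A : Pic_Φ(A) ⥲ ℝ`".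
[cite: MochizukiFrdI2008, Cor. 5.4 p.104]

PROOF-ONLY file (seat abc-iut-w5-d048, L1-lead R111 (2); no definitions). The as-typed strong 1-uniqueness
clause of Cor. 5.4 at THE data reduces (`FrdI.Cor54Sub.strongUnique_of_rigidAlong_untrToRlf`, p420214, +
`FrdI.Cor54Sub.rigidAlong_of_essSurj_of_homRigid`, `Cor54RigidityReduction.lean`) to two properties of the
model-level realification functor `untrToRlf : C^un-tr → C^rlf`; this file proves the first one for `C_{K/F}`:

* `GpSubfunctor.nonempty_iso_of_div_mem` (generic) — in the model Frobenioid of `(Φ, Ψ)` with `Ψ ⊆ Φ^gp` a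
  subfunctor of groups, `(A, α) ≅ (A, β)` as soon as `α / β ∈ Ψ(A)` (the unit-isomorphism `(1, id, 0, α/β)`);
* **`FrdI.Cor54Sub.untrToRlf_essSurj_arith`** — for `F` a number field and ANY witness `hΦ` that the arithmetic
  divisor monoid `Φ` of `C_{K/F}` is perf-factorial, `untrToRlf : C_{K/F}^un-tr → C_{K/F}^rlf` is ESSENTIALLY
  SURJECTIVE: every object `(Spec L, ξ)`, `ξ ∈ (Φ^rlf)^gp(L)` a real arithmetic divisor class, is isomorphic to
  the image `(Spec L, ι^gp(c))` of an object with `c ∈ Φ^gp(L)`, because `ξ ≡ ι^gp(c)` modulo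
  `(ℝ · Φ^birat)(L)` for a suitable archimedean adjustment `c` (abc-iut-L1-d2's
  `ArithRlfPic.arith_exists_div_toRlfGp_mem_realSpan`, from `δ_A : Pic ⥲ ℝ`).

Nothing here bears on [IUTchIII] Cor. 3.12; typed ≠ proved elsewhere.
-/

noncomputable section

namespace Literature.AlgebraicGeometry.Frobenioids

open CategoryTheory Opposite

universe w v u

/-! ### Unit isomorphisms in the model Frobenioid of `(Φ, Ψ)` -/

namespace GpSubfunctor

variable {D : Type u} [Category.{v} D] {Φ : Dᵒᵖ ⥤ CommMonCat.{w}} (Ψ : GpSubfunctor Φ)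

/-- In the model Frobenioid of `(Φ, Ψ)` (`Ψ ⊆ Φ^gp` a subfunctor of groups, `Div_B` the inclusion): if
`α / β ∈ Ψ(A)` then `(A, α) ≅ (A, β)`, by the mutually inverse unit-isomorphisms `(1, id_A, 0, α/β)` and
`(1, id_A, 0, β/α)` (relation (d) of Thm. 5.2 (i): `α = β · (α/β)`). [cite: MochizukiFrdI2008, Thm. 5.2 (i) p.100] -/
theorem nonempty_iso_of_div_mem {A : D} (α β : Algebra.GrothendieckGroup (Φ.obj (op A)))
    (h : α / β ∈ Ψ.carrier A) : Nonempty ((⟨A, α⟩ : Ψ.ModelOf) ≅ ⟨A, β⟩) := by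
  refine ⟨{ hom := { degFr := 1, base := 𝟙 A, div := 1, unit := ⟨α / β, h⟩, rel := ?_ }
            inv := { degFr := 1, base := 𝟙 A, div := 1, unit := ⟨(α / β)⁻¹, inv_mem h⟩, rel := ?_ }
            hom_inv_id := ?_
            inv_hom_id := ?_ }⟩
  · change α ^ ((1 : ℕ+) : ℕ) * Algebra.GrothendieckGroup.of 1 = pullGp Φ (𝟙 A) β * (α / β)
    rw [PNat.one_coe, pow_one, map_one, mul_one, pullGp_id, mul_div_cancel]
  · change β ^ ((1 : ℕ+) : ℕ) * Algebra.GrothendieckGroup.of 1 = pullGp Φ (𝟙 A) α * (α / β)⁻¹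
    rw [PNat.one_coe, pow_one, map_one, mul_one, pullGp_id, inv_div, mul_div_cancel]
  · apply ModelFrobenioid.hom_ext
    · rfl
    · exact Category.comp_id _
    · change (Φ.map (𝟙 A).op).hom 1 * 1 ^ ((1 : ℕ+) : ℕ) = 1
      rw [map_one, one_pow, mul_one]
    · apply Subtype.ext
      change pullGp Φ (𝟙 A) (α / β)⁻¹ * (α / β) ^ ((1 : ℕ+) : ℕ) = 1
      rw [pullGp_id, PNat.one_coe, pow_one, inv_mul_cancel]
  · apply ModelFrobenioid.hom_ext
    · rfl
    · exact Category.comp_id _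
    · change (Φ.map (𝟙 A).op).hom 1 * 1 ^ ((1 : ℕ+) : ℕ) = 1
      rw [map_one, one_pow, mul_one]
    · apply Subtype.ext
      change pullGp Φ (𝟙 A) (α / β) * (α / β)⁻¹ ^ ((1 : ℕ+) : ℕ) = 1
      rw [pullGp_id, PNat.one_coe, pow_one, mul_inv_cancel]

end GpSubfunctor

/-! ### Essential surjectivity of `C_{K/F}^un-tr → C_{K/F}^rlf` -/

namespace FrdI.Cor54Sub

open NumberField

variable {F : Type} [Field F] [NumberField F] {K : Type} [Field K] [Algebra F K]

/-- **(a′) for `C_{K/F}`: the realification functor `untrToRlf : C_{K/F}^un-tr → C_{K/F}^rlf` (model descriptions,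
THE data `RealificationData.canonical`) is essentially surjective** — every object `(Spec L, ξ)` of `C_{K/F}^rlf`
is isomorphic to `untrToRlf (Spec L, c)` for some integral class `c ∈ Φ^gp(L)`, since `ξ / ι^gp(c) ∈ (ℝ · Φ^birat)(L)`
for an archimedean adjustment `c` (`δ_A : Pic_Φ(A) ⥲ ℝ`, Thm. 6.4 (i)). [cite: MochizukiFrdI2008, Cor. 5.4 p.104] -/
theorem untrToRlf_essSurj_arith (hΦ : PreFrobenioid.IsPerfFactorialOn (arithDivisorFunctor F K)) :
    (PreFrobenioid.untrToRlf
      (ModelFrobenioid.toElem (arithDivisorFunctor F K) (unitsFunctor F K) (divNatTrans F K)) hΦ).EssSurj := by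
  refine ⟨fun Y => ?_⟩
  obtain ⟨A, ξ⟩ := Y
  obtain ⟨c, hc⟩ := ArithRlfPic.arith_exists_div_toRlfGp_mem_realSpan hΦ A ξ
  refine ⟨⟨A, c⟩, ?_⟩
  -- the image object is `(A, ι^gp(c))` on the nose
  change Nonempty ((⟨A, (RealificationData.canonical (arithDivisorFunctor F K)
      (PreFrobenioid.IsPerfFactorialOn.op hΦ)).toRlfGp A c⟩ : (RealificationData.canonical (arithDivisorFunctor F K)
        (PreFrobenioid.IsPerfFactorialOn.op hΦ)).RlfModelOf _) ≅ ⟨A, ξ⟩)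
  refine GpSubfunctor.nonempty_iso_of_div_mem _ _ _ ?_
  rw [← inv_div]
  exact inv_mem hc

/-- The same in the bare-existence form consumed by `FrdI.Cor54Sub.rigidAlong_of_exists_iso_of_homRigid`.
[cite: MochizukiFrdI2008, Cor. 5.4 p.104] -/
theorem untrToRlf_exists_iso_arith (hΦ : PreFrobenioid.IsPerfFactorialOn (arithDivisorFunctor F K))
    (Y : PreFrobenioid.rlf
      (ModelFrobenioid.toElem (arithDivisorFunctor F K) (unitsFunctor F K) (divNatTrans F K)) hΦ) :
    ∃ a : PreFrobenioid.untrModel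
        (ModelFrobenioid.toElem (arithDivisorFunctor F K) (unitsFunctor F K) (divNatTrans F K)),
      Nonempty ((PreFrobenioid.untrToRlf
        (ModelFrobenioid.toElem (arithDivisorFunctor F K) (unitsFunctor F K) (divNatTrans F K)) hΦ).obj a ≅ Y) :=
  (untrToRlf_essSurj_arith hΦ).mem_essImage Y

end FrdI.Cor54Sub

end Literature.AlgebraicGeometry.Frobenioids

end
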